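import Mathlib

/-!
# Crux `WordLengthQP` (stmt-ValiantsHypothesis-6623), line `positive-monoid-exits` —
stub `stub_sandwich`: the `S`-sandwich identity `P₀^rev · E₀₂(F) · P₁^rev = S · M · S`

A real affine elementary word of width 3 is a list of letters
`l = (i, j, c, o) : Fin 3 × Fin 3 × ℝ × Option σ` with matrix
`Matrix.transvection i j (C c * o.elim 1 X)` (`E_ij(c)` for `o = none`, `E_ij(c · x_v)` for
`o = some v`); the value of a word is the product of its letter matrices.

**Sandwich identity.** Let `S = diag(1, -1, 1)`.  If a word `P₀ ++ M ++ P₁` whose outer blocks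
`P₀`, `P₁` consist of ADJACENT letters (`|i - j| = 1`, any sign of the coefficient) computes
`E₀₂(F)`, then `P₀^rev · E₀₂(F) · P₁^rev = S · M · S`, where `P^rev` denotes the product of the
letter matrices of `P` in reverse order (and `M` the product of the letter matrices of `M`).

Proof: (A) every adjacent letter matrix `T` satisfies `T S T = S` (`sw_adj_mul_S_mul_adj`), hence
for a block `P` of adjacent letters `P S P^rev = S = P^rev S P`, i.e. `S P^rev S` is the two-sided
inverse of `P` since `S² = 1` (`sw_prod_mul_S_mul_rev`, `sw_S_mul_S`); (B) in any monoid with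
`S² = 1`, `P₀ (T P₁) = E` with (A) for the members of `P₀`, `P₁` gives
`S T S = P₀^rev (S E S) P₁^rev` (`sw_isolate`); (C) `S E₀₂(F) S = E₀₂(F)` (`sw_S_mul_far_mul_S`).

References: the `S`-conjugation `P ↦ S P⁻¹ S` of (totally positive) matrices is
[FallatJohnson2011] Thm 1.3.3 (background only; no total nonnegativity is used here); the identity
itself is folklore linear algebra.  The four helper lemmas are adapted from the (private) lemmas
`kgt_S_mul_S`, `kgt_adj_mul_S_mul_adj`, `kgt_S_mul_far_mul_S`, `kgt_prod_mul_S_mul_rev`,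
`kgt_isolate` of the landed rung-1 file
`Summits/ValiantsHypothesis/ValiantsHypothesis/Theorems/ElementaryWordLengthWordLengthQPStubKappaGeTwo.lean`.
-/

-- `Summit.ValiantsHypothesis.ValiantsHypothesis.…` is the tree's mandated single-conjunct layout
-- (Sub = Summit), so the duplicated namespace component is intended.
set_option linter.dupNamespace false

noncomputable section

namespace Summit.ValiantsHypothesis.ValiantsHypothesis.Cruxes.WordLengthQP.PositiveMonoidExits

/-! ## (A) adjacent letters are inverted by conjugation with `S = diag(1, -1, 1)` -/

-- adapted from …/Theorems/ElementaryWordLengthWordLengthQPStubKappaGeTwo.lean (`kgt_S_mul_S`)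
/-- `S² = 1` for `S = diag(1, -1, 1)`. [folklore] -/
private theorem sw_S_mul_S {R : Type*} [CommRing R] :
    Matrix.diagonal ![(1 : R), -1, 1] * Matrix.diagonal ![(1 : R), -1, 1] = 1 := by
  ext i j
  fin_cases i <;> fin_cases j <;> simp

-- adapted from …/Theorems/ElementaryWordLengthWordLengthQPStubKappaGeTwo.lean
-- (`kgt_adj_mul_S_mul_adj`)
/-- (A): for an ADJACENT transvection `T = E_ij(a)` (`|i - j| = 1`, any `a`), `T S T = S`,
i.e. `S T S = T⁻¹`. [folklore] -/
private theorem sw_adj_mul_S_mul_adj {R : Type*} [CommRing R] (i j : Fin 3)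
    (hij : i.val + 1 = j.val ∨ j.val + 1 = i.val) (a : R) :
    Matrix.transvection i j a * Matrix.diagonal ![(1 : R), -1, 1] * Matrix.transvection i j a =
      Matrix.diagonal ![(1 : R), -1, 1] := by
  fin_cases i <;> fin_cases j <;> simp at hij <;>
  · ext k l
    fin_cases k <;> fin_cases l <;>
      simp [Matrix.transvection, Matrix.mul_apply, Fin.sum_univ_three, Matrix.one_apply]

-- adapted from …/Theorems/ElementaryWordLengthWordLengthQPStubKappaGeTwo.lean
-- (`kgt_S_mul_far_mul_S`)
/-- (C): `S E₀₂(f) S = E₀₂(f)` (`S₀₀ S₂₂ = 1`). [folklore] -/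
private theorem sw_S_mul_far_mul_S {R : Type*} [CommRing R] (f : R) :
    Matrix.diagonal ![(1 : R), -1, 1] * Matrix.transvection (0 : Fin 3) 2 f *
      Matrix.diagonal ![(1 : R), -1, 1] = Matrix.transvection (0 : Fin 3) 2 f := by
  ext k l
  fin_cases k <;> fin_cases l <;>
    simp [Matrix.transvection, Matrix.mul_apply, Fin.sum_univ_three, Matrix.one_apply]

-- adapted from …/Theorems/ElementaryWordLengthWordLengthQPStubKappaGeTwo.lean
-- (`kgt_prod_mul_S_mul_rev`)
/-- In a monoid: if every `T` in a list satisfies `T S T = S`, then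
`(∏ Ts) S (∏ Ts.reverse) = S` and `(∏ Ts.reverse) S (∏ Ts) = S` (for `S² = 1` this says that
`S (∏ Ts.reverse) S` is the two-sided inverse of `∏ Ts`). [folklore] -/
private theorem sw_prod_mul_S_mul_rev {M : Type*} [Monoid M] (S : M) (Ts : List M)
    (h : ∀ T ∈ Ts, T * S * T = S) :
    Ts.prod * S * Ts.reverse.prod = S ∧ Ts.reverse.prod * S * Ts.prod = S := by
  induction Ts with
  | nil => simp
  | cons T Ts ih =>
    have hT := h T (by simp)
    obtain ⟨ih1, ih2⟩ := ih (fun U hU => h U (by simp [hU]))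
    simp only [List.prod_cons, List.reverse_cons, List.prod_append, List.prod_nil, mul_one]
    constructor
    · calc T * Ts.prod * S * (Ts.reverse.prod * T)
          = T * (Ts.prod * S * Ts.reverse.prod) * T := by simp only [mul_assoc]
        _ = S := by rw [ih1, hT]
    · calc Ts.reverse.prod * T * S * (T * Ts.prod)
          = Ts.reverse.prod * (T * S * T) * Ts.prod := by simp only [mul_assoc]
        _ = S := by rw [hT, ih2]

/-! ## (B) isolating the middle block -/

-- adapted from …/Theorems/ElementaryWordLengthWordLengthQPStubKappaGeTwo.lean (`kgt_isolate`)
/-- (B) (in a monoid, `S² = 1`): if `(∏ Ts₀) T (∏ Ts₁) = E` with `U S U = S` for every `U` in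
`Ts₀`, `Ts₁`, then `S T S = (∏ Ts₀.reverse) (S E S) (∏ Ts₁.reverse)`. [folklore] -/
private theorem sw_isolate {M : Type*} [Monoid M] (S : M) (hSS : S * S = 1) (Ts0 Ts1 : List M)
    (T E : M) (h0 : ∀ U ∈ Ts0, U * S * U = S) (h1 : ∀ U ∈ Ts1, U * S * U = S)
    (h : Ts0.prod * (T * Ts1.prod) = E) :
    S * T * S = Ts0.reverse.prod * (S * E * S) * Ts1.reverse.prod := by
  obtain ⟨-, hA0⟩ := sw_prod_mul_S_mul_rev S Ts0 h0
  obtain ⟨hA1, -⟩ := sw_prod_mul_S_mul_rev S Ts1 h1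
  have hL : S * Ts0.reverse.prod * S * Ts0.prod = 1 := by
    calc S * Ts0.reverse.prod * S * Ts0.prod
        = S * (Ts0.reverse.prod * S * Ts0.prod) := by simp only [mul_assoc]
      _ = 1 := by rw [hA0, hSS]
  have hR : Ts1.prod * S * Ts1.reverse.prod * S = 1 := by rw [hA1, hSS]
  calc S * T * S
      = S * ((S * Ts0.reverse.prod * S * Ts0.prod) * T *
          (Ts1.prod * S * Ts1.reverse.prod * S)) * S := by rw [hL, hR, one_mul, mul_one]
    _ = (S * S) * Ts0.reverse.prod * (S * (Ts0.prod * (T * Ts1.prod)) * S) *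
          Ts1.reverse.prod * (S * S) := by simp only [mul_assoc]
    _ = Ts0.reverse.prod * (S * E * S) * Ts1.reverse.prod := by rw [h, hSS, one_mul, mul_one]

/-! ## The sandwich identity for words -/

/-- **Sandwich identity** (infrastructure stub of line `positive-monoid-exits`; the public form of
the rung-1 file's private `kgt_isolate`): if a word `P₀ ++ M ++ P₁` whose outer blocks `P₀`, `P₁`
consist of ADJACENT letters computes `E₀₂(F)`, then `P₀^rev · E₀₂(F) · P₁^rev = S · M · S` with
`S = diag(1, -1, 1)` (`T S T = S` for adjacent letters, `S E₀₂(F) S = E₀₂(F)`, `S² = 1`).  With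
`M = q₁⁻¹ P₁' q₂⁻¹ ⋯ q_K⁻¹` this is the normal form `P₀^rev E P_K^rev = q₁⁺ P₁'^# q₂⁺ ⋯ q_K⁺` behind
every rung of the sign budget.  [folklore; background: FallatJohnson2011 Thm 1.3.3 (`S A⁻¹ S`)] -/
theorem stub_sandwich {σ : Type} (P₀ M P₁ : List (Fin 3 × Fin 3 × ℝ × Option σ))
    (F : MvPolynomial σ ℝ)
    (h₀ : ∀ l ∈ P₀, l.1.val + 1 = l.2.1.val ∨ l.2.1.val + 1 = l.1.val)
    (h₁ : ∀ l ∈ P₁, l.1.val + 1 = l.2.1.val ∨ l.2.1.val + 1 = l.1.val)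
    (h : ((P₀ ++ M ++ P₁).map (fun l => Matrix.transvection l.1 l.2.1
        (MvPolynomial.C l.2.2.1 * l.2.2.2.elim 1 MvPolynomial.X))).prod =
        Matrix.transvection (0 : Fin 3) 2 F) :
    (P₀.reverse.map (fun l => Matrix.transvection l.1 l.2.1
        (MvPolynomial.C l.2.2.1 * l.2.2.2.elim 1 MvPolynomial.X))).prod *
      Matrix.transvection (0 : Fin 3) 2 F *
    (P₁.reverse.map (fun l => Matrix.transvection l.1 l.2.1
        (MvPolynomial.C l.2.2.1 * l.2.2.2.elim 1 MvPolynomial.X))).prod =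
    Matrix.diagonal ![(1 : MvPolynomial σ ℝ), -1, 1] *
      (M.map (fun l => Matrix.transvection l.1 l.2.1
        (MvPolynomial.C l.2.2.1 * l.2.2.2.elim 1 MvPolynomial.X))).prod *
      Matrix.diagonal ![(1 : MvPolynomial σ ℝ), -1, 1] := by
  -- `h : P₀ (M P₁) = E₀₂(F)` as a product of the three block values
  rw [List.map_append, List.map_append, List.prod_append, List.prod_append, mul_assoc] at h
  -- (B) with `T := M`, `E := E₀₂(F)`; (A) discharges the side conditions on `P₀`, `P₁`
  have hB := sw_isolate (Matrix.diagonal ![(1 : MvPolynomial σ ℝ), -1, 1])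
    sw_S_mul_S _ _ _ _ (fun U hU => ?_) (fun U hU => ?_) h
  rotate_left
  · obtain ⟨l, hl, rfl⟩ := List.mem_map.1 hU
    exact sw_adj_mul_S_mul_adj _ _ (h₀ l hl) _
  · obtain ⟨l, hl, rfl⟩ := List.mem_map.1 hU
    exact sw_adj_mul_S_mul_adj _ _ (h₁ l hl) _
  -- (C) `S E₀₂(F) S = E₀₂(F)`, and `P.reverse.map mat = (P.map mat).reverse`
  rw [sw_S_mul_far_mul_S] at hB
  rw [List.map_reverse, List.map_reverse, hB, mul_assoc]

end Summit.ValiantsHypothesis.ValiantsHypothesis.Cruxes.WordLengthQP.PositiveMonoidExits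

end
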